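import Literature.Computability.Complexity.CNF
import HarnessLib

/-!
# CNF formulas: discharges of the named facts of `CNF.lean`

Sibling proof file of `Literature/Computability/Complexity/CNF.lean` (D-0014: a named fact
`def X : Prop` is discharged as `theorem X_holds : X`; users' hypotheses `(h : X)` are then fed
`X_holds`). It discharges

* `Literature.Computability.Complexity.CNF.satisfiedFraction_eq_one_iff_holds` — under any
  assignment `σ`, the fraction `CNF.satisfiedFraction φ σ` of clauses of `φ` satisfied by `σ`
  equals `1` iff `φ.eval σ = true` (every clause is satisfied);
* `Literature.Computability.Complexity.CNF.maxSatFraction_eq_one_iff_holds` — the MAX-SAT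
  value `val(φ) = CNF.maxSatFraction φ` equals `1` iff `φ` is satisfiable.

Source. S. Arora, B. Barak, *Computational Complexity: A Modern Approach* (CUP 2009), §11.1,
Definition 11.1 (Approximation of MAX-3SAT): "For every 3CNF formula `φ`, the value of `φ`,
denoted by `val(φ)`, is the maximum fraction of clauses that can be satisfied by any assignment
to `φ`'s variables. In particular, `φ` is satisfiable iff `val(φ) = 1`." The fact discharged
first is the per-assignment form of that remark (the satisfied fraction of one assignment is
`1` iff it satisfies every clause); the second is the remark itself, obtained by maximising
over the finitely many assignments to `φ.vars` (padded by `false`). The vendored docstrings in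
`CNF.lean` write "§11.2" for `val(φ)`; in print Definition 11.1 sits in §11.1 (locator slip
only, the statements are faithful).

## Proof

Unfold `satisfiedFraction`/`numClauses`. If `φ` has no clauses then `φ = []`, the fraction is
`1` by the documented vacuous convention and `CNF.eval [] σ = true`. Otherwise, with
`m = φ.length ≠ 0`, `#sat / m = 1 ↔ #sat = m` (`div_eq_one_iff_eq`, `Nat.cast_inj`),
`#sat = m ↔ ∀ c ∈ φ, c.eval σ` (`List.countP_eq_length`), and the right-hand side is
`φ.eval σ = true` (`CNF.eval_eq_true_iff`).

For `val(φ) = 1 ↔ φ.Satisfiable`: (`→`) the maximum over the finite nonempty set of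
assignments to `φ.vars` is attained (`Finset.exists_mem_eq_sup'`), and an assignment with
satisfied fraction `1` satisfies `φ` by the first fact; (`←`) the value of `φ` depends only on
the variables occurring in it (private `eval_eq_true_of_eqOn_vars`, a twin of `CNF.eval_congr`
of `ParsimoniousCookLevin.lean` kept private to avoid that file's import closure), so a
satisfying assignment restricted to `φ.vars` and padded by `false` still satisfies `φ`, giving
`1 ≤ val(φ)` (`Finset.le_sup'`), while `val(φ) ≤ 1` by `CNF.satisfiedFraction_le_one`.

## References

* S. Arora, B. Barak, *Computational Complexity: A Modern Approach*, Cambridge University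
  Press 2009, §11.1, Def. 11.1 (`val(φ)`; "`φ` is satisfiable iff `val(φ) = 1`").
-/

namespace Literature.Computability.Complexity.CNF

universe u

variable {ν : Type u}

/-- Discharge of the named fact `satisfiedFraction_eq_one_iff`: for every CNF `φ` and
assignment `σ`, the fraction of clauses of `φ` satisfied by `σ` equals `1` iff every clause of
`φ` is satisfied, i.e. iff `φ.eval σ = true`. For the empty CNF both sides hold (documented
vacuous convention `satisfiedFraction [] σ = 1`, and `CNF.eval [] σ = true`); otherwise
`#sat / m = 1 ↔ #sat = m ↔ ∀ c ∈ φ, c.eval σ = true`. Per-assignment form of the remark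
"`φ` is satisfiable iff `val(φ) = 1`" in the definition of the MAX-3SAT value `val(φ)` (the
maximum fraction of clauses satisfiable by one assignment).
[Arora–Barak 2009, §11.1, Def. 11.1] [cite: AroraBarak2009, Def. 11.1] -/
theorem satisfiedFraction_eq_one_iff_holds : satisfiedFraction_eq_one_iff (ν := ν) := by
  intro φ σ
  unfold satisfiedFraction numClauses
  split_ifs with h
  · rw [List.length_eq_zero_iff.mp h]
    simp
  · rw [div_eq_one_iff_eq (Nat.cast_ne_zero.mpr h), Nat.cast_inj, List.countP_eq_length,
      eval_eq_true_iff]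


/-- Private twin of `CNF.eval_congr` / `CNF.mem_vars_of_mem` of `ParsimoniousCookLevin.lean`
(whose Cook–Levin import closure is not wanted in this basic proof file): if `σ'` agrees with
`σ` on the variables occurring in `φ` and `σ` satisfies `φ`, then so does `σ'` — a true literal
of each clause stays true. [folklore] -/
private theorem eval_eq_true_of_eqOn_vars [DecidableEq ν] {φ : CNF ν} {σ σ' : ν → Bool}
    (h : ∀ x ∈ φ.vars, σ' x = σ x) (hσ : φ.eval σ = true) : φ.eval σ' = true := by
  rw [eval_eq_true_iff] at hσ ⊢
  intro c hc
  have hc' := hσ c hc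
  simp only [Clause.eval, List.any_eq_true] at hc' ⊢
  obtain ⟨l, hl, hval⟩ := hc'
  have hx : l.1 ∈ φ.vars := by
    unfold CNF.vars
    rw [List.mem_toFinset, List.mem_map]
    exact ⟨l, List.mem_flatten.2 ⟨c, hc, hl⟩, rfl⟩
  refine ⟨l, hl, ?_⟩
  simpa [Literal.eval, h l.1 hx] using hval

/-- Discharge of the named fact `maxSatFraction_eq_one_iff`: the MAX-SAT value
`val(φ) = CNF.maxSatFraction φ` (the maximum over assignments to `φ.vars`, padded by `false`,
of the satisfied fraction) equals `1` iff `φ` is satisfiable. (`→`) the finite maximum is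
attained (`Finset.exists_mem_eq_sup'`) by some padded assignment, whose satisfied fraction is
then `1`, so it satisfies every clause (`satisfiedFraction_eq_one_iff_holds`). (`←`) a
satisfying `σ` restricted to `φ.vars` and padded by `false` agrees with `σ` on `φ.vars`, hence
still satisfies `φ` and has satisfied fraction `1 ≤ val(φ)`; and `val(φ) ≤ 1` always
(`satisfiedFraction_le_one`). For `φ = []` both sides hold (`val([]) = 1`, `[]` satisfiable).
This is the remark "In particular, `φ` is satisfiable iff `val(φ) = 1`" of the source.
[Arora–Barak 2009, §11.1, Def. 11.1] [cite: AroraBarak2009, Def. 11.1] -/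
theorem maxSatFraction_eq_one_iff_holds : maxSatFraction_eq_one_iff (ν := ν) := by
  intro _ φ
  unfold maxSatFraction
  constructor
  · intro h1
    obtain ⟨τ, -, hτ⟩ := Finset.exists_mem_eq_sup' Finset.univ_nonempty
      fun τ : φ.vars → Bool =>
        φ.satisfiedFraction fun x => if h : x ∈ φ.vars then τ ⟨x, h⟩ else false
    exact ⟨_, (satisfiedFraction_eq_one_iff_holds φ _).1 (hτ.symm.trans h1)⟩
  · rintro ⟨σ, hσ⟩
    apply le_antisymm
    · exact Finset.sup'_le _ _ fun τ _ => satisfiedFraction_le_one φ _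
    · refine le_trans (le_of_eq ?_)
        (Finset.le_sup' _ (Finset.mem_univ fun y : φ.vars => σ y.1))
      exact ((satisfiedFraction_eq_one_iff_holds φ _).2
        (eval_eq_true_of_eqOn_vars (fun x hx => by simp [hx]) hσ)).symm

end Literature.Computability.Complexity.CNF
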